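import Literature.IUT.HodgeTheaters.GlobalFrobenioidsCyclotomeIsoGenuineKummerInfKappaX
import Literature.IUT.HodgeTheaters.GlobalFrobenioidsCoricFieldLevelNonVacuity
import HarnessLib

/-!
# [IUTchI] Example 5.1 (v), p. 128 l. 1–12 (E51/L27, FACT-LIST F-2582) — the GENUINE-CONTAINER closers FIRE at an
# inhabited datum (NV annex; proof-only)

S. Mochizuki, *Inter-universal Teichmüller theory I*, kurims manuscript (May 2020), §5 Example 5.1 (v), p. 128
([IUTchI] Ex 5.1 (v) p.128) [claim: Mochizuki2012, status: disputed].  Cell abc-iut, block C / F, tranche 190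
(abc-iut-f-190), row F-2582 `UniqueCyclotomeIso`.

The field-level closers `NFBridgeRecon.uniqueCyclotomeIso_infκ_fieldLevel` (p443183,
`GlobalFrobenioidsCyclotomeIsoGenuineKummer.lean`) and `…_infκx_fieldLevel` (p443477, `…InfKappaX.lean`) derive the
one-layer cyclotome display AT THE GENUINE ∞κ / ∞κ× KUMMER CONTAINER from the binders `hrootU hprim hdiv ord hordmul`
+ Rmk 3.1.7 (i)/(ii) — a SUBSET of the binder list of the LAYER-5 certificate's conjunct 1/2 at field level
(`layer5_held_ex51v_v5_fieldLevel`).  abc-iut-w4-d050's NV annex `NFBridgeRecon.CoricLawsToy.exists_fieldLevel_laws`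
(`GlobalFrobenioidsCoricFieldLevelNonVacuity.lean`, p441507) exhibits ONE interface datum `N` (GENUINE Galois side
`G_ℚ ↷ ℚ̄`, non-commutative; degenerate toy on the function-field side — see that file's honest label) at which all
those binders hold.  **This file** (`NFBridgeRecon.CoricLawsToy.exists_uniqueCyclotomeIso_fieldLevel_fires`): at that
datum BOTH genuine-container closers FIRE — the hypothesis set of the E51/L27 closers is JOINTLY SATISFIABLE together
with a non-commutative `π₁^rat`, and the conclusions `UniqueCyclotomeIso ⟨Λ(K_rat^×), Λ(K_rat^×), lim_{→H} H¹, lim_{→H} H¹,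
κ(𝕄^⊛_∞κ), κ(𝕄^⊛_∞κ), χ-twist⟩` (resp. `∞κ×`) hold there.  HONEST LABEL: NV annex; **inhabited ≠ discharged; no
census change**; not a claim about the genuine `Gal(L̄_C/L_C)`-datum of print.  PROOF-ONLY: no `def`, no `instance`,
no new Prop fact.  No side is taken on [IUTchIII] Cor. 3.12; nothing of the disputed series is asserted; typed ≠ proved.
-/

namespace Literature.IUT.HodgeTheaters

open ProfiniteGrp ProfiniteGrp.ProfiniteCompletion
open Literature.AnabelianGeometry.EtaleTheta Literature.AnabelianGeometry.EtaleTheta.ZHatLevel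

namespace NFBridgeRecon

namespace CoricLawsToy

open scoped Classical in
/-- **The E51/L27 genuine-container closers FIRE at abc-iut-w4-d050's field-level toy datum** (shape check by name):
there are an interface datum `N` with NON-COMMUTATIVE `π₁^rat`, points `X`, orders `ord`, and proofs of the field-level
side-conditions `hrootU`/`hprim`, such that the one-layer cyclotome display holds at the GENUINE ∞κ Kummer container of
`N` AND at the genuine ∞κ× container (the comparison data of `uniqueCyclotomeIso_infκ_fieldLevel` /
`uniqueCyclotomeIso_infκx_fieldLevel`, verbatim).  NV annex; inhabited ≠ discharged.
([IUTchI] Ex 5.1 (v) p.128) [claim: Mochizuki2012, status: disputed] -/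
theorem exists_uniqueCyclotomeIso_fieldLevel_fires :
    ∃ (N : NFBridgeRecon.{0}) (hrootU : ∀ {n : ℕ}, n ≠ 0 → Function.Surjective fun a : N.Kratˣ => a ^ n)
      (hprim : ∀ n : ℕ, 0 < n → ∃ ζ : N.Krat, IsPrimitiveRoot ζ n),
      (∃ a b : N.piRat, a * b ≠ b * a) ∧
      (letI : MulDistribMulAction N.piRat N.Kratˣ := Units.mulDistribMulActionRight
       letI : RootableBy N.Kratˣ ℕ := rootableByOfPowLeftSurj N.Kratˣ ℕ hrootU
       haveI : Nonempty (OpenNormalSubgroup N.piRat)ᵒᵈ :=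
         ⟨OrderDual.toDual { toOpenSubgroup := ⊤, isNormal' := Subgroup.normal_of_characteristic ⊤ }⟩
       UniqueCyclotomeIso
        { μ₁ := cyclotome N.Kratˣ
          μ₂ := cyclotome N.Kratˣ
          H₁ := H1Colimit N.Kratˣ
            (fun i : (OpenNormalSubgroup N.piRat)ᵒᵈ => ((OrderDual.ofDual i : OpenNormalSubgroup N.piRat) : Subgroup N.piRat))
            N.openNormal_antitone
          H₂ := H1Colimit N.Kratˣ
            (fun i : (OpenNormalSubgroup N.piRat)ᵒᵈ => ((OrderDual.ofDual i : OpenNormalSubgroup N.piRat) : Subgroup N.piRat))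
            N.openNormal_antitone
          im₁ := Set.range fun f : N.infκPair.carrier =>
            kummerMap N.openNormal_antitone (N.isExhausted_openNormal fun _ _ => rfl)
              (Units.mk0 (f : N.Krat) (N.coe_infκPair_ne_zero f))
          im₂ := Set.range fun f : N.infκPair.carrier =>
            kummerMap N.openNormal_antitone (N.isExhausted_openNormal fun _ _ => rfl)
              (Units.mk0 (f : N.Krat) (N.coe_infκPair_ne_zero f))
          induced := fun e => H1ColimTwist
            (fun i : (OpenNormalSubgroup N.piRat)ᵒᵈ => ((OrderDual.ofDual i : OpenNormalSubgroup N.piRat) : Subgroup N.piRat))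
            N.openNormal_antitone
            ((Equiv.ofBijective _ (cyclotome.zhatTwist_bijective (R := N.Krat) hprim)).symm e) }) ∧
      (letI : MulDistribMulAction N.piRat N.Kratˣ := Units.mulDistribMulActionRight
       letI : RootableBy N.Kratˣ ℕ := rootableByOfPowLeftSurj N.Kratˣ ℕ hrootU
       haveI : Nonempty (OpenNormalSubgroup N.piRat)ᵒᵈ :=
         ⟨OrderDual.toDual { toOpenSubgroup := ⊤, isNormal' := Subgroup.normal_of_characteristic ⊤ }⟩
       UniqueCyclotomeIso
        { μ₁ := cyclotome N.Kratˣ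
          μ₂ := cyclotome N.Kratˣ
          H₁ := H1Colimit N.Kratˣ
            (fun i : (OpenNormalSubgroup N.piRat)ᵒᵈ => ((OrderDual.ofDual i : OpenNormalSubgroup N.piRat) : Subgroup N.piRat))
            N.openNormal_antitone
          H₂ := H1Colimit N.Kratˣ
            (fun i : (OpenNormalSubgroup N.piRat)ᵒᵈ => ((OrderDual.ofDual i : OpenNormalSubgroup N.piRat) : Subgroup N.piRat))
            N.openNormal_antitone
          im₁ := Set.range fun f : N.infκxPair.carrier =>
            kummerMap N.openNormal_antitone (N.isExhausted_openNormal fun _ _ => rfl)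
              (Units.mk0 (f : N.Krat) (N.coe_ne_zero_of_subset N.Minfκx _ N.zero_notMem f))
          im₂ := Set.range fun f : N.infκxPair.carrier =>
            kummerMap N.openNormal_antitone (N.isExhausted_openNormal fun _ _ => rfl)
              (Units.mk0 (f : N.Krat) (N.coe_ne_zero_of_subset N.Minfκx _ N.zero_notMem f))
          induced := fun e => H1ColimTwist
            (fun i : (OpenNormalSubgroup N.piRat)ᵒᵈ => ((OrderDual.ofDual i : OpenNormalSubgroup N.piRat) : Subgroup N.piRat))
            N.openNormal_antitone
            ((Equiv.ofBijective _ (cyclotome.zhatTwist_bijective (R := N.Krat) hprim)).symm e) }) := by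
  obtain ⟨N, X, ord, hne, hroot, hprim, -, -, -, -, hdiv, hordmul, hpole, hzero, hpolex, hzerox⟩ :=
    exists_fieldLevel_laws
  exact ⟨N, fun hn => N.units_pow_surjective_of_roots hroot hn, hprim, hne,
    N.uniqueCyclotomeIso_infκ_fieldLevel (fun hn => N.units_pow_surjective_of_roots hroot hn) hprim hdiv ord
      hordmul hpole hzero,
    N.uniqueCyclotomeIso_infκx_fieldLevel (fun hn => N.units_pow_surjective_of_roots hroot hn) hprim hdiv ord
      hordmul hpolex hzerox⟩

end CoricLawsToy

end NFBridgeRecon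

end Literature.IUT.HodgeTheaters
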